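import Summits.Ventures.YMGap.FlowData.KernelRatioJensen
import Summits.Ventures.YMGap.FlowData.RectTubeVacuumSector
import HarnessLib

/-!
# Venture YMGap, track Y3 FLOW-DATA — the DERIVATIVE-FREE Hellmann–Feynman sandwich in the Wilson coupling:
# `(J₂ − J₁)·Φ(J₁) ≤ log ‖T_{J₂}‖ − log ‖T_{J₁}‖ ≤ (J₂ − J₁)·Φ(J₂)`, `Φ(J)` = the vacuum expectation of ALL plaquettes of a
# time step (spatial + temporal) at coupling `J` (theorems only)

HONEST FRAMING: venture file of the cell `pub-ymgap` (QuantumFields programme), track Y3 (FLOW-DATA), for the rectangular tube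
`T_J = rectTubeTransferOperator ρ J Ls`.  A RELATION between two FLOW-TABLE columns — the chord slopes of O0 (`ln λ₀`) and the
plaquette expectations of O7 (`P_s`, `P_t`) — on ONE finite tube: every chord slope of `J ↦ log ‖T_J‖` lies between the total
plaquette expectations at its two ends (convexity + Hellmann–Feynman WITHOUT derivatives; the differentiable cubic statement is
`TubeTransferLogNormDerivative.lean`, the magnetic-only leg is `RectTubeMagneticSecant.lean`).  No number, no row, nothing about
`L → ∞`, the continuum or a mass gap.

THE ARGUMENT (Kingman–Jensen, `KernelRatioJensen.lean`).  With `Ω₁ ≥ 0` the vacuum of `T_{J₁}` and the probability density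
`F₁ = Ω₁(a)K_{J₁}(a,b)Ω₁(b)/λ₀(J₁)` on pairs of slices, `‖T_{J₂}‖ ≥ ⟪Ω₁,T_{J₂}Ω₁⟫ = λ₀(J₁)∫(K_{J₂}/K_{J₁})F₁`; Jensen for `F₁` and,
inside `log(K_{J₂}/K_{J₁}) = (J₂−J₁)(mag a + mag b)/2 + log(∫e^{J₂ elec}dE/∫e^{J₁ elec}dE)`, Jensen for the conditional temporal
measure `e^{J₁ elec}dE/∫e^{J₁ elec}dE`, give `log ‖T_{J₂}‖ − log ‖T_{J₁}‖ ≥ (J₂−J₁)Φ(J₁)` with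
`Φ(J) = λ₀(J)⁻¹ ∫ [(mag a + mag b)/2 + ⟨elec⟩_{J,(a,b)}] Ω_J(a)K_J(a,b)Ω_J(b)`; swapping `J₁ ↔ J₂` gives the upper bound.  No
positivity of `T` is used (only `K > 0`, `Ω ≥ 0`).

* `log_integral_exp_rectElecSum_sub_ge` (the conditional Jensen), `exists_rectSliceKernel_ratio_bounds`, `continuous_integral_mul_exp_rect`,
  `continuous_rectOneStepLoad`, `rectAnisoLoad_le_log_ratio` (two couplings `(J_E,J_M) → (J_E',J_M')`, reused by `RectTubeAnisoSecant.lean`),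
  `rectOneStepLoad_mul_le_log_ratio` (pointwise `(J₂−J₁)·load_{J₁} ≤ log(K_{J₂}/K_{J₁})`);
* **`rectTube_log_norm_sub_ge_coupling`**, **`rectTube_log_norm_sub_le_coupling`** — the sandwich for any real `J₁, J₂` and
  nonnegative unit vacua `Ω₁`, `Ω₂` (they exist and are a.e. positive: `RectTubeVacuumSector.exists_rectVacuum`);
* the cell's reading (`J = β/2`, `Re tr = 2·½Tr` for `SU(2)`): `(β₂ − β₁)·Φ̂(β₁) ≤ ln λ₀(β₂) − ln λ₀(β₁) ≤ (β₂ − β₁)·Φ̂(β₂)` with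
  `Φ̂(β) = ⟨Σ_{spatial p} ½Tr U_p + Σ_{temporal p} ½Tr U_p⟩_{vacuum,β}` (`= N_sp·P_s + N_ℓ·P_t` in FLOW-PLAN's un-normalised
  dictionary) — **`su2_rectTube_log_norm_secant_ge`** / **`_le`**.

References: J. F. C. Kingman, Quart. J. Math. 12 (1961) 283 [cite: Kingman1961]; M. Reed, B. Simon IV (1978) §XIII.12
[cite: ReedSimonIV1978, §XIII.12]; I. Montvay, G. Münster (1994) §3.2.6 [cite: MontvayMunster1994, §3.2.6].
-/

noncomputable section

open scoped BigOperators ENNReal RealInnerProductSpace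
open MeasureTheory Filter Function
open Literature.MathematicalPhysics.QuantumFieldTheory Literature.Analysis.OperatorTheory
open Literature.MathematicalPhysics.QuantumLattice (RectTorusSite fundamentalRep continuous_fundamentalRep
  fundamentalRep_mem_unitaryGroup)

namespace Summit.Ventures.YMGap.FlowData

/-! ### The tube: conditional Jensen for the temporal links and the coupling sandwich -/

section Tube

variable {G : Type*} [Group G] [TopologicalSpace G] [IsTopologicalGroup G] [CompactSpace G]
  [MeasurableSpace G] [BorelSpace G] [SecondCountableTopology G] {n k : ℕ} (ρ : G →* Matrix (Fin n) (Fin n) ℂ)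
  {Ls : Fin k → ℕ} [∀ i, NeZero (Ls i)]

/-- The conditional temporal expectation `⟨elec⟩_{J,(a,b)} = (∫ elec e^{J elec} dE)/(∫ e^{J elec} dE)`, and the total one-step
plaquette load `h_J(a,b) = (mag(a)+mag(b))/2 + ⟨elec⟩_{J,(a,b)}` — written inline below; this lemma is the pointwise
**conditional Jensen**: `log ∫e^{J₂ elec} − log ∫e^{J₁ elec} ≥ (J₂ − J₁)·⟨elec⟩_{J₁,(a,b)}`. [cite: Kingman1961] -/
theorem log_integral_exp_rectElecSum_sub_ge (hρ : Continuous ρ) (hρu : ∀ g, ρ g ∈ Matrix.unitaryGroup (Fin n) ℂ)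
    (J₁ J₂ : ℝ) (a b : RectSlice Ls G) :
    (J₂ - J₁) * ((∫ E, rectElecSum (Ls := Ls) ρ a E b * Real.exp (J₁ * rectElecSum (Ls := Ls) ρ a E b)
        ∂(Measure.pi fun _ : RectTorusSite Ls => haarProbability G)) /
      (∫ E, Real.exp (J₁ * rectElecSum (Ls := Ls) ρ a E b) ∂(Measure.pi fun _ : RectTorusSite Ls => haarProbability G))) ≤
    Real.log (∫ E, Real.exp (J₂ * rectElecSum (Ls := Ls) ρ a E b) ∂(Measure.pi fun _ : RectTorusSite Ls => haarProbability G)) -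
      Real.log (∫ E, Real.exp (J₁ * rectElecSum (Ls := Ls) ρ a E b) ∂(Measure.pi fun _ : RectTorusSite Ls => haarProbability G)) := by
  set ν : Measure (RectTorusSite Ls → G) := Measure.pi fun _ : RectTorusSite Ls => haarProbability G with hν
  have htr : ∀ g : G, |(ρ g).trace.re| ≤ n := fun g =>
    (Complex.abs_re_le_norm _).trans (Literature.Barriers.QuantumFields.FiniteTemperature.norm_trace_le_of_mem_unitaryGroup (hρu _))
  have hqb : ∀ E : RectTorusSite Ls → G, |rectElecSum (Ls := Ls) ρ a E b| ≤ n * Fintype.card (RectTorusSite Ls × Fin k) := by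
    intro E
    unfold rectElecSum
    refine (Finset.abs_sum_le_sum_abs _ _).trans ?_
    refine (Finset.sum_le_sum fun x _ => (Finset.abs_sum_le_sum_abs _ _).trans
      (Finset.sum_le_sum fun i _ => htr _)).trans (le_of_eq ?_)
    simp only [Finset.sum_const, Finset.card_univ, Fintype.card_prod, Fintype.card_fin]
    push_cast; ring
  have hc1 : ∀ y : RectTorusSite Ls, Continuous fun E : RectTorusSite Ls → G => E y := fun y => continuous_apply y
  have hq : Continuous fun E : RectTorusSite Ls → G => rectElecSum (Ls := Ls) ρ a E b := by
    unfold rectElecSum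
    refine continuous_finsetSum _ fun x _ => continuous_finsetSum _ fun i _ => ?_
    exact (Complex.continuous_re.comp (Continuous.matrix_trace hρ)).comp
      ((((hc1 x).mul continuous_const).mul (hc1 _).inv).mul continuous_const)
  set k₁ : ℝ := ∫ E, Real.exp (J₁ * rectElecSum (Ls := Ls) ρ a E b) ∂ν with hk₁
  have hk₁pos : 0 < k₁ := (continuous_pos_integral_exp_rect (G := G) (rectElecSum (Ls := Ls) ρ) (continuous_rectElecSum (Ls := Ls) ρ hρ) J₁).2 a b
  -- density `p = e^{J₁ elec}/k₁`, function `f = (J₂ − J₁) elec`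
  have hpi : Integrable (fun E => Real.exp (J₁ * rectElecSum (Ls := Ls) ρ a E b) / k₁) ν :=
    ((Real.continuous_exp.comp (continuous_const.mul hq)).integrable_of_hasCompactSupport
      (HasCompactSupport.of_compactSpace _)).div_const _
  have hp0 : ∀ᵐ E ∂ν, 0 ≤ Real.exp (J₁ * rectElecSum (Ls := Ls) ρ a E b) / k₁ :=
    Eventually.of_forall fun E => div_nonneg (Real.exp_pos _).le hk₁pos.le
  have hp1 : ∫ E, Real.exp (J₁ * rectElecSum (Ls := Ls) ρ a E b) / k₁ ∂ν = 1 := by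
    rw [integral_div, ← hk₁, div_self hk₁pos.ne']
  have hfm : AEStronglyMeasurable (fun E : RectTorusSite Ls → G => (J₂ - J₁) * rectElecSum (Ls := Ls) ρ a E b) ν :=
    (continuous_const.mul hq).aestronglyMeasurable
  have hfb : ∀ E : RectTorusSite Ls → G, ‖(J₂ - J₁) * rectElecSum (Ls := Ls) ρ a E b‖ ≤ |J₂ - J₁| * (n * Fintype.card (RectTorusSite Ls × Fin k)) :=
    fun E => by rw [norm_mul, Real.norm_eq_abs, Real.norm_eq_abs]; exact mul_le_mul_of_nonneg_left (hqb E) (abs_nonneg _)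
  have hJ := integral_mul_le_log_integral_exp_mul (f := fun E => (J₂ - J₁) * rectElecSum (Ls := Ls) ρ a E b) hp0 hpi hp1 hfm hfb
  -- rewrite both sides
  have hL : ∫ E, (J₂ - J₁) * rectElecSum (Ls := Ls) ρ a E b * (Real.exp (J₁ * rectElecSum (Ls := Ls) ρ a E b) / k₁) ∂ν =
      (J₂ - J₁) * ((∫ E, rectElecSum (Ls := Ls) ρ a E b * Real.exp (J₁ * rectElecSum (Ls := Ls) ρ a E b) ∂ν) / k₁) := by
    rw [← integral_div, ← integral_const_mul]
    refine integral_congr_ae (Eventually.of_forall fun E => ?_)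
    dsimp only
    ring
  have hR : ∫ E, Real.exp ((J₂ - J₁) * rectElecSum (Ls := Ls) ρ a E b) * (Real.exp (J₁ * rectElecSum (Ls := Ls) ρ a E b) / k₁) ∂ν =
      (∫ E, Real.exp (J₂ * rectElecSum (Ls := Ls) ρ a E b) ∂ν) / k₁ := by
    rw [← integral_div]
    refine integral_congr_ae (Eventually.of_forall fun E => ?_)
    dsimp only
    rw [mul_div_assoc', ← Real.exp_add]
    congr 2; ring
  rw [hL, hR, Real.log_div ((continuous_pos_integral_exp_rect (G := G) (rectElecSum (Ls := Ls) ρ)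
    (continuous_rectElecSum (Ls := Ls) ρ hρ) J₂).2 a b).ne' hk₁pos.ne'] at hJ
  exact hJ

/-- **Ratio bounds**: two Wilson slice kernels have a ratio bounded above and below by positive constants (continuous positive
kernels on a compact space). [folklore] -/
theorem exists_rectSliceKernel_ratio_bounds (hρ : Continuous ρ) (JE JM JE' JM' : ℝ) :
    ∃ R₀ R₁ : ℝ, 0 < R₀ ∧ ∀ x y : RectSlice Ls G,
      R₀ ≤ rectSliceKernel (Ls := Ls) ρ JE' JM' x y / rectSliceKernel (Ls := Ls) ρ JE JM x y ∧
        rectSliceKernel (Ls := Ls) ρ JE' JM' x y / rectSliceKernel (Ls := Ls) ρ JE JM x y ≤ R₁ := by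
  have hKc := continuous_rectSliceKernel (Ls := Ls) ρ hρ JE JM
  have hK'c := continuous_rectSliceKernel (Ls := Ls) ρ hρ JE' JM'
  obtain ⟨C, hC⟩ := exists_rectSliceKernel_le (Ls := Ls) ρ hρ JE JM
  obtain ⟨C', hC'⟩ := exists_rectSliceKernel_le (Ls := Ls) ρ hρ JE' JM'
  have hKpos := rectSliceKernel_pos (Ls := Ls) ρ hρ JE JM
  have hK'pos := rectSliceKernel_pos (Ls := Ls) ρ hρ JE' JM'
  obtain ⟨⟨a₀, b₀⟩, -, hz₀⟩ := isCompact_univ.exists_isMinOn Set.univ_nonempty hKc.continuousOn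
  obtain ⟨⟨a₁, b₁⟩, -, hz₁⟩ := isCompact_univ.exists_isMinOn Set.univ_nonempty hK'c.continuousOn
  have hKmin : ∀ x y, rectSliceKernel (Ls := Ls) ρ JE JM a₀ b₀ ≤ rectSliceKernel (Ls := Ls) ρ JE JM x y :=
    fun x y => (isMinOn_iff.1 hz₀) (x, y) (Set.mem_univ _)
  have hK'min : ∀ x y, rectSliceKernel (Ls := Ls) ρ JE' JM' a₁ b₁ ≤ rectSliceKernel (Ls := Ls) ρ JE' JM' x y :=
    fun x y => (isMinOn_iff.1 hz₁) (x, y) (Set.mem_univ _)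
  set m₀ : ℝ := rectSliceKernel (Ls := Ls) ρ JE JM a₀ b₀ with hm₀
  set m₁ : ℝ := rectSliceKernel (Ls := Ls) ρ JE' JM' a₁ b₁ with hm₁
  have hm0 : 0 < m₀ := hKpos a₀ b₀
  have hm1 : 0 < m₁ := hK'pos a₁ b₁
  have hKle : ∀ x y, rectSliceKernel (Ls := Ls) ρ JE JM x y ≤ C := fun x y =>
    (le_abs_self _).trans ((Real.norm_eq_abs _).symm.le.trans (hC x y))
  have hK'le : ∀ x y, rectSliceKernel (Ls := Ls) ρ JE' JM' x y ≤ C' := fun x y =>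
    (le_abs_self _).trans ((Real.norm_eq_abs _).symm.le.trans (hC' x y))
  have hC0 : 0 < C := lt_of_lt_of_le hm0 (hKle a₀ b₀)
  refine ⟨m₁ / C, C' / m₀, div_pos hm1 hC0, fun x y => ⟨?_, ?_⟩⟩
  · exact div_le_div₀ (hK'pos x y).le (hK'min x y) (hKpos x y) (hKle x y)
  · exact div_le_div₀ ((hK'pos x y).le.trans (hK'le x y)) (hK'le x y) hm0 (hKmin x y)

/-- Continuity of `p ↦ ∫ q(p.1,E,p.2) e^{J q(p.1,E,p.2)} dE` for a jointly continuous `q` on a compact first-countable `X`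
(dominated convergence; abstract `q`, as in `RectSliceKernel.continuous_pos_integral_exp_rect`). [folklore] -/
theorem continuous_integral_mul_exp_rect {X : Type*} [TopologicalSpace X] [CompactSpace X] [FirstCountableTopology X]
    (q : X → (RectTorusSite Ls → G) → X → ℝ)
    (hq : Continuous fun z : (X × X) × (RectTorusSite Ls → G) => q z.1.1 z.2 z.1.2) (J : ℝ) :
    Continuous fun p : X × X => ∫ E, q p.1 E p.2 * Real.exp (J * q p.1 E p.2)
      ∂(Measure.pi fun _ : RectTorusSite Ls => haarProbability G) := by
  have hFc : Continuous fun z : (X × X) × (RectTorusSite Ls → G) => q z.1.1 z.2 z.1.2 * Real.exp (J * q z.1.1 z.2 z.1.2) :=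
    hq.mul (Real.continuous_exp.comp (continuous_const.mul hq))
  obtain ⟨B, hB⟩ := isCompact_univ.exists_bound_of_continuousOn hFc.continuousOn
  refine continuous_of_dominated (F := fun (p : X × X) (E : RectTorusSite Ls → G) => q p.1 E p.2 * Real.exp (J * q p.1 E p.2))
    (bound := fun _ => B) (fun p => ?_) (fun p => ?_) (integrable_const B) (Eventually.of_forall fun E => ?_)
  · exact (hFc.comp (Continuous.prodMk continuous_const continuous_id)).aestronglyMeasurable
  · exact Eventually.of_forall fun E => hB (p, E) (Set.mem_univ _)
  · exact hFc.comp (Continuous.prodMk continuous_id continuous_const)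

/-- **The one-step plaquette load is continuous** in the pair of slices:
`z ↦ (mag z.1 + mag z.2)/2 + (∫ elec e^{J elec} dE)/(∫ e^{J elec} dE)` (dominated convergence on a compact space). [folklore] -/
theorem continuous_rectOneStepLoad (hρ : Continuous ρ) (J : ℝ) :
    Continuous fun z : RectSlice Ls G × RectSlice Ls G =>
      (rectMagSum (Ls := Ls) ρ z.1 + rectMagSum (Ls := Ls) ρ z.2) / 2 +
        (∫ E, rectElecSum (Ls := Ls) ρ z.1 E z.2 * Real.exp (J * rectElecSum (Ls := Ls) ρ z.1 E z.2)
            ∂(Measure.pi fun _ : RectTorusSite Ls => haarProbability G)) /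
          (∫ E, Real.exp (J * rectElecSum (Ls := Ls) ρ z.1 E z.2) ∂(Measure.pi fun _ : RectTorusSite Ls => haarProbability G)) := by
  have hm := continuous_rectMagSum (Ls := Ls) ρ hρ
  have hden := continuous_pos_integral_exp_rect (G := G) (rectElecSum (Ls := Ls) ρ) (continuous_rectElecSum ρ hρ) J
  have hnum := continuous_integral_mul_exp_rect (G := G) (rectElecSum (Ls := Ls) ρ) (continuous_rectElecSum ρ hρ) J
  exact (((hm.comp continuous_fst).add (hm.comp continuous_snd)).div_const _).add
    (hnum.div hden.1 fun z => (hden.2 z.1 z.2).ne')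

/-- **Pointwise, two couplings: `(J_M'−J_M)(mag a + mag b)/2 + (J_E'−J_E)·⟨elec⟩_{J_E,(a,b)} ≤ log (K_{J_E',J_M'}/K_{J_E,J_M})(a,b)`**
(the magnetic part is an identity, the temporal part is the conditional Jensen `log_integral_exp_rectElecSum_sub_ge`). [cite: Kingman1961] -/
theorem rectAnisoLoad_le_log_ratio (hρ : Continuous ρ) (hρu : ∀ g, ρ g ∈ Matrix.unitaryGroup (Fin n) ℂ) (JE JM JE' JM' : ℝ)
    (z : RectSlice Ls G × RectSlice Ls G) :
    (JM' - JM) * ((rectMagSum (Ls := Ls) ρ z.1 + rectMagSum (Ls := Ls) ρ z.2) / 2) +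
      (JE' - JE) * ((∫ E, rectElecSum (Ls := Ls) ρ z.1 E z.2 * Real.exp (JE * rectElecSum (Ls := Ls) ρ z.1 E z.2)
            ∂(Measure.pi fun _ : RectTorusSite Ls => haarProbability G)) /
          (∫ E, Real.exp (JE * rectElecSum (Ls := Ls) ρ z.1 E z.2) ∂(Measure.pi fun _ : RectTorusSite Ls => haarProbability G))) ≤
      Real.log (rectSliceKernel (Ls := Ls) ρ JE' JM' z.1 z.2 / rectSliceKernel (Ls := Ls) ρ JE JM z.1 z.2) := by
  have hcond := log_integral_exp_rectElecSum_sub_ge ρ (Ls := Ls) hρ hρu JE JE' z.1 z.2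
  have hI1 := (continuous_pos_integral_exp_rect (G := G) (rectElecSum (Ls := Ls) ρ) (continuous_rectElecSum (Ls := Ls) ρ hρ) JE).2 z.1 z.2
  have hI2 := (continuous_pos_integral_exp_rect (G := G) (rectElecSum (Ls := Ls) ρ) (continuous_rectElecSum (Ls := Ls) ρ hρ) JE').2 z.1 z.2
  have hlog : Real.log (rectSliceKernel (Ls := Ls) ρ JE' JM' z.1 z.2 / rectSliceKernel (Ls := Ls) ρ JE JM z.1 z.2) =
      (JM' - JM) * ((rectMagSum (Ls := Ls) ρ z.1 + rectMagSum (Ls := Ls) ρ z.2) / 2) +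
      (Real.log (∫ E, Real.exp (JE' * rectElecSum (Ls := Ls) ρ z.1 E z.2) ∂(Measure.pi fun _ : RectTorusSite Ls => haarProbability G)) -
        Real.log (∫ E, Real.exp (JE * rectElecSum (Ls := Ls) ρ z.1 E z.2) ∂(Measure.pi fun _ : RectTorusSite Ls => haarProbability G))) := by
    rw [Real.log_div (rectSliceKernel_pos ρ hρ JE' JM' _ _).ne' (rectSliceKernel_pos ρ hρ JE JM _ _).ne']
    unfold rectSliceKernel
    rw [Real.log_mul (mul_pos (Real.exp_pos _) hI2).ne' (Real.exp_pos _).ne', Real.log_mul (Real.exp_pos _).ne' hI2.ne',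
      Real.log_mul (mul_pos (Real.exp_pos _) hI1).ne' (Real.exp_pos _).ne', Real.log_mul (Real.exp_pos _).ne' hI1.ne',
      Real.log_exp, Real.log_exp, Real.log_exp, Real.log_exp]
    ring
  rw [hlog]
  linarith

/-- **Pointwise, common coupling: `(J₂ − J₁)·load_{J₁}(a,b) ≤ log (K_{J₂}(a,b)/K_{J₁}(a,b))`.** [cite: Kingman1961] -/
theorem rectOneStepLoad_mul_le_log_ratio (hρ : Continuous ρ) (hρu : ∀ g, ρ g ∈ Matrix.unitaryGroup (Fin n) ℂ) (J₁ J₂ : ℝ)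
    (z : RectSlice Ls G × RectSlice Ls G) :
    (J₂ - J₁) * ((rectMagSum (Ls := Ls) ρ z.1 + rectMagSum (Ls := Ls) ρ z.2) / 2 +
        (∫ E, rectElecSum (Ls := Ls) ρ z.1 E z.2 * Real.exp (J₁ * rectElecSum (Ls := Ls) ρ z.1 E z.2)
            ∂(Measure.pi fun _ : RectTorusSite Ls => haarProbability G)) /
          (∫ E, Real.exp (J₁ * rectElecSum (Ls := Ls) ρ z.1 E z.2) ∂(Measure.pi fun _ : RectTorusSite Ls => haarProbability G))) ≤
      Real.log (rectSliceKernel (Ls := Ls) ρ J₂ J₂ z.1 z.2 / rectSliceKernel (Ls := Ls) ρ J₁ J₁ z.1 z.2) := by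
  have h := rectAnisoLoad_le_log_ratio ρ (Ls := Ls) hρ hρu J₁ J₁ J₂ J₂ z
  rw [mul_add]
  exact h

/-- **The coupling sandwich, lower half: `(J₂ − J₁)·Φ(J₁) ≤ log ‖T_{J₂}‖ − log ‖T_{J₁}‖`**, where
`Φ(J₁) = λ₀(J₁)⁻¹ ∫∫ [(mag a + mag b)/2 + ⟨elec⟩_{J₁,(a,b)}] Ω₁(a) K_{J₁}(a,b) Ω₁(b)` is the one-step total plaquette expectation in the
vacuum `Ω₁ ≥ 0` of `T_{J₁}` (any real `J₁, J₂`; continuous unitary `ρ`).  [cite: Kingman1961] [cite: ReedSimonIV1978, §XIII.12] -/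
theorem rectTube_log_norm_sub_ge_coupling (hρ : Continuous ρ) (hρu : ∀ g, ρ g ∈ Matrix.unitaryGroup (Fin n) ℂ) (J₁ J₂ : ℝ)
    {Ω : Lp ℝ 2 (rectSliceMeasure G Ls)} (h1 : ‖Ω‖ = 1) (hΩ : ∀ᵐ a ∂(rectSliceMeasure G Ls), 0 ≤ Ω a)
    (heig : rectTubeTransferOperator ρ J₁ Ls Ω = ‖rectTubeTransferOperator ρ J₁ Ls‖ • Ω) :
    (J₂ - J₁) * (‖rectTubeTransferOperator ρ J₁ Ls‖⁻¹ *
      ∫ z, ((rectMagSum (Ls := Ls) ρ z.1 + rectMagSum (Ls := Ls) ρ z.2) / 2 +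
          (∫ E, rectElecSum (Ls := Ls) ρ z.1 E z.2 * Real.exp (J₁ * rectElecSum (Ls := Ls) ρ z.1 E z.2)
              ∂(Measure.pi fun _ : RectTorusSite Ls => haarProbability G)) /
            (∫ E, Real.exp (J₁ * rectElecSum (Ls := Ls) ρ z.1 E z.2) ∂(Measure.pi fun _ : RectTorusSite Ls => haarProbability G))) *
        (Ω z.1 * rectSliceKernel (Ls := Ls) ρ J₁ J₁ z.1 z.2 * Ω z.2) ∂((rectSliceMeasure G Ls).prod (rectSliceMeasure G Ls))) ≤
      Real.log ‖rectTubeTransferOperator ρ J₂ Ls‖ - Real.log ‖rectTubeTransferOperator ρ J₁ Ls‖ := by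
  have hKc := continuous_rectSliceKernel (Ls := Ls) ρ hρ J₁ J₁
  have hK'c := continuous_rectSliceKernel (Ls := Ls) ρ hρ J₂ J₂
  obtain ⟨C, hC⟩ := exists_rectSliceKernel_le (Ls := Ls) ρ hρ J₁ J₁
  obtain ⟨C', hC'⟩ := exists_rectSliceKernel_le (Ls := Ls) ρ hρ J₂ J₂
  have hKpos := rectSliceKernel_pos (Ls := Ls) ρ hρ J₁ J₁
  obtain ⟨R₀, R₁, hR₀, hR⟩ := exists_rectSliceKernel_ratio_bounds ρ (Ls := Ls) hρ J₁ J₁ J₂ J₂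
  have hmain := log_norm_sub_log_norm_ge_integral_log_ratio (μ := rectSliceMeasure G Ls) hKc.stronglyMeasurable hC
    hK'c.stronglyMeasurable hC' hKpos hR₀ hR (rectTubeTransferOperator_ae_eq J₁ Ls hρ) (rectTubeTransferOperator_ae_eq J₂ Ls hρ)
    (norm_rectTubeTransferOperator_pos J₁ Ls hρ) h1 hΩ heig
  refine le_trans ?_ hmain
  -- integrate the pointwise bound against the nonnegative `ΩKΩ`
  have hI : Integrable (fun z : RectSlice Ls G × RectSlice Ls G => Ω z.1 * (rectSliceKernel (Ls := Ls) ρ J₁ J₁ z.1 z.2 * Ω z.2))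
      ((rectSliceMeasure G Ls).prod (rectSliceMeasure G Ls)) := integrable_mul_kernel_mul hKc.stronglyMeasurable hC Ω Ω
  have hΩ1 : ∀ᵐ z ∂((rectSliceMeasure G Ls).prod (rectSliceMeasure G Ls)), 0 ≤ Ω z.1 :=
    (Measure.quasiMeasurePreserving_fst (μ := rectSliceMeasure G Ls) (ν := rectSliceMeasure G Ls)).ae hΩ
  have hΩ2 : ∀ᵐ z ∂((rectSliceMeasure G Ls).prod (rectSliceMeasure G Ls)), 0 ≤ Ω z.2 :=
    (Measure.quasiMeasurePreserving_snd (μ := rectSliceMeasure G Ls) (ν := rectSliceMeasure G Ls)).ae hΩ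
  have hhc := continuous_rectOneStepLoad ρ (Ls := Ls) hρ J₁
  obtain ⟨Bh, hBh⟩ := isCompact_univ.exists_bound_of_continuousOn hhc.continuousOn
  have hlogc : AEStronglyMeasurable (fun z : RectSlice Ls G × RectSlice Ls G =>
      Real.log (rectSliceKernel (Ls := Ls) ρ J₂ J₂ z.1 z.2 / rectSliceKernel (Ls := Ls) ρ J₁ J₁ z.1 z.2))
      ((rectSliceMeasure G Ls).prod (rectSliceMeasure G Ls)) :=
    (Real.measurable_log.comp (hK'c.measurable.div hKc.measurable)).aestronglyMeasurable
  have hlogb : ∀ z : RectSlice Ls G × RectSlice Ls G,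
      ‖Real.log (rectSliceKernel (Ls := Ls) ρ J₂ J₂ z.1 z.2 / rectSliceKernel (Ls := Ls) ρ J₁ J₁ z.1 z.2)‖ ≤ max |Real.log R₀| |Real.log R₁| := by
    intro z
    obtain ⟨hlo, hhi⟩ := hR z.1 z.2
    have hRpos : 0 < rectSliceKernel (Ls := Ls) ρ J₂ J₂ z.1 z.2 / rectSliceKernel (Ls := Ls) ρ J₁ J₁ z.1 z.2 := lt_of_lt_of_le hR₀ hlo
    rw [Real.norm_eq_abs, abs_le]
    constructor
    · have := Real.log_le_log hR₀ hlo
      linarith [neg_abs_le (Real.log R₀), le_max_left |Real.log R₀| |Real.log R₁|]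
    · have := Real.log_le_log hRpos hhi
      linarith [le_abs_self (Real.log R₁), le_max_right |Real.log R₀| |Real.log R₁|]
  have hi1 := (hI.congr (Eventually.of_forall fun z => show Ω z.1 * (rectSliceKernel (Ls := Ls) ρ J₁ J₁ z.1 z.2 * Ω z.2) =
      Ω z.1 * rectSliceKernel (Ls := Ls) ρ J₁ J₁ z.1 z.2 * Ω z.2 by ring)).bdd_mul (hhc.aestronglyMeasurable.const_mul (J₂ - J₁))
      (c := ‖J₂ - J₁‖ * Bh) (Eventually.of_forall fun z => by
        rw [norm_mul]; exact mul_le_mul_of_nonneg_left (hBh z (Set.mem_univ _)) (norm_nonneg _))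
  have hi2 := (hI.congr (Eventually.of_forall fun z => show Ω z.1 * (rectSliceKernel (Ls := Ls) ρ J₁ J₁ z.1 z.2 * Ω z.2) =
      Ω z.1 * rectSliceKernel (Ls := Ls) ρ J₁ J₁ z.1 z.2 * Ω z.2 by ring)).bdd_mul hlogc (Eventually.of_forall hlogb)
  rw [← mul_assoc, mul_comm (J₂ - J₁), mul_assoc, ← integral_const_mul]
  have hi1' : Integrable (fun z : RectSlice Ls G × RectSlice Ls G => (J₂ - J₁) *
      (((rectMagSum (Ls := Ls) ρ z.1 + rectMagSum (Ls := Ls) ρ z.2) / 2 +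
        (∫ E, rectElecSum (Ls := Ls) ρ z.1 E z.2 * Real.exp (J₁ * rectElecSum (Ls := Ls) ρ z.1 E z.2)
            ∂(Measure.pi fun _ : RectTorusSite Ls => haarProbability G)) /
          (∫ E, Real.exp (J₁ * rectElecSum (Ls := Ls) ρ z.1 E z.2) ∂(Measure.pi fun _ : RectTorusSite Ls => haarProbability G))) *
        (Ω z.1 * rectSliceKernel (Ls := Ls) ρ J₁ J₁ z.1 z.2 * Ω z.2)))
      ((rectSliceMeasure G Ls).prod (rectSliceMeasure G Ls)) :=
    hi1.congr (Eventually.of_forall fun z => by ring)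
  refine mul_le_mul_of_nonneg_left (integral_mono_ae hi1' hi2 ?_) (inv_nonneg.2 (norm_nonneg _))
  filter_upwards [hΩ1, hΩ2] with z h1z h2z
  have hW : 0 ≤ Ω z.1 * rectSliceKernel (Ls := Ls) ρ J₁ J₁ z.1 z.2 * Ω z.2 :=
    mul_nonneg (mul_nonneg h1z (hKpos z.1 z.2).le) h2z
  have h := mul_le_mul_of_nonneg_right (rectOneStepLoad_mul_le_log_ratio ρ (Ls := Ls) hρ hρu J₁ J₂ z) hW
  calc _ = (J₂ - J₁) * ((rectMagSum (Ls := Ls) ρ z.1 + rectMagSum (Ls := Ls) ρ z.2) / 2 +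
        (∫ E, rectElecSum (Ls := Ls) ρ z.1 E z.2 * Real.exp (J₁ * rectElecSum (Ls := Ls) ρ z.1 E z.2)
            ∂(Measure.pi fun _ : RectTorusSite Ls => haarProbability G)) /
          (∫ E, Real.exp (J₁ * rectElecSum (Ls := Ls) ρ z.1 E z.2) ∂(Measure.pi fun _ : RectTorusSite Ls => haarProbability G))) *
        (Ω z.1 * rectSliceKernel (Ls := Ls) ρ J₁ J₁ z.1 z.2 * Ω z.2) := by ring
    _ ≤ _ := h

/-- **The coupling sandwich, upper half: `log ‖T_{J₂}‖ − log ‖T_{J₁}‖ ≤ (J₂ − J₁)·Φ(J₂)`** with the vacuum `Ω₂ ≥ 0` of `T_{J₂}`.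
[cite: Kingman1961] [cite: ReedSimonIV1978, §XIII.12] -/
theorem rectTube_log_norm_sub_le_coupling (hρ : Continuous ρ) (hρu : ∀ g, ρ g ∈ Matrix.unitaryGroup (Fin n) ℂ) (J₁ J₂ : ℝ)
    {Ω' : Lp ℝ 2 (rectSliceMeasure G Ls)} (h1 : ‖Ω'‖ = 1) (hΩ : ∀ᵐ a ∂(rectSliceMeasure G Ls), 0 ≤ Ω' a)
    (heig : rectTubeTransferOperator ρ J₂ Ls Ω' = ‖rectTubeTransferOperator ρ J₂ Ls‖ • Ω') :
    Real.log ‖rectTubeTransferOperator ρ J₂ Ls‖ - Real.log ‖rectTubeTransferOperator ρ J₁ Ls‖ ≤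
      (J₂ - J₁) * (‖rectTubeTransferOperator ρ J₂ Ls‖⁻¹ *
      ∫ z, ((rectMagSum (Ls := Ls) ρ z.1 + rectMagSum (Ls := Ls) ρ z.2) / 2 +
          (∫ E, rectElecSum (Ls := Ls) ρ z.1 E z.2 * Real.exp (J₂ * rectElecSum (Ls := Ls) ρ z.1 E z.2)
              ∂(Measure.pi fun _ : RectTorusSite Ls => haarProbability G)) /
            (∫ E, Real.exp (J₂ * rectElecSum (Ls := Ls) ρ z.1 E z.2) ∂(Measure.pi fun _ : RectTorusSite Ls => haarProbability G))) *
        (Ω' z.1 * rectSliceKernel (Ls := Ls) ρ J₂ J₂ z.1 z.2 * Ω' z.2) ∂((rectSliceMeasure G Ls).prod (rectSliceMeasure G Ls))) := by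
  have h := rectTube_log_norm_sub_ge_coupling ρ (Ls := Ls) hρ hρu J₂ J₁ h1 hΩ heig
  have hneg : (J₁ - J₂) = -(J₂ - J₁) := by ring
  rw [hneg, neg_mul] at h
  linarith

end Tube


/-! ### The cell's `SU(2)` reading -/

section SU2

variable {k : ℕ}

/-- **`((β₂ − β₁)/2)·Φ(β₁/2) ≤ ln λ₀(β₂) − ln λ₀(β₁)`** for the `SU(2)` tube (`J = β/2`; in `Φ`, `Re tr U_p = 2·½Tr U_p`, so
`((β₂−β₁)/2)·Φ = (β₂−β₁)·⟨Σ_p ½Tr U_p over the spatial AND temporal plaquettes of one time step⟩_{vacuum β₁}`), for every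
nonnegative unit vacuum `Ω` of `T_{β₁/2}`. [cite: Kingman1961] [cite: MontvayMunster1994, §3.2.6] -/
theorem su2_rectTube_log_norm_secant_ge (β₁ β₂ : ℝ) (Ls : Fin k → ℕ) [∀ i, NeZero (Ls i)]
    {Ω : Lp ℝ 2 (rectSliceMeasure (Matrix.specialUnitaryGroup (Fin 2) ℂ) Ls)} (h1 : ‖Ω‖ = 1)
    (hΩ : ∀ᵐ a ∂(rectSliceMeasure (Matrix.specialUnitaryGroup (Fin 2) ℂ) Ls), 0 ≤ Ω a)
    (heig : rectTubeTransferOperator (fundamentalRep (Fin 2)) (β₁ / 2) Ls Ω =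
      ‖rectTubeTransferOperator (fundamentalRep (Fin 2)) (β₁ / 2) Ls‖ • Ω) :
    (β₂ / 2 - β₁ / 2) * (‖rectTubeTransferOperator (fundamentalRep (Fin 2)) (β₁ / 2) Ls‖⁻¹ *
      ∫ z, ((rectMagSum (Ls := Ls) (fundamentalRep (Fin 2)) z.1 + rectMagSum (Ls := Ls) (fundamentalRep (Fin 2)) z.2) / 2 +
          (∫ E, rectElecSum (Ls := Ls) (fundamentalRep (Fin 2)) z.1 E z.2 *
                Real.exp (β₁ / 2 * rectElecSum (Ls := Ls) (fundamentalRep (Fin 2)) z.1 E z.2)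
              ∂(Measure.pi fun _ : RectTorusSite Ls => haarProbability (Matrix.specialUnitaryGroup (Fin 2) ℂ))) /
            (∫ E, Real.exp (β₁ / 2 * rectElecSum (Ls := Ls) (fundamentalRep (Fin 2)) z.1 E z.2)
              ∂(Measure.pi fun _ : RectTorusSite Ls => haarProbability (Matrix.specialUnitaryGroup (Fin 2) ℂ)))) *
        (Ω z.1 * rectSliceKernel (Ls := Ls) (fundamentalRep (Fin 2)) (β₁ / 2) (β₁ / 2) z.1 z.2 * Ω z.2)
        ∂((rectSliceMeasure (Matrix.specialUnitaryGroup (Fin 2) ℂ) Ls).prod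
          (rectSliceMeasure (Matrix.specialUnitaryGroup (Fin 2) ℂ) Ls))) ≤
      Real.log ‖rectTubeTransferOperator (fundamentalRep (Fin 2)) (β₂ / 2) Ls‖ -
        Real.log ‖rectTubeTransferOperator (fundamentalRep (Fin 2)) (β₁ / 2) Ls‖ := by
  haveI : SecondCountableTopology (Matrix.specialUnitaryGroup (Fin 2) ℂ) :=
    Literature.MathematicalPhysics.QuantumLattice.secondCountableTopology_su2
  exact rectTube_log_norm_sub_ge_coupling (fundamentalRep (Fin 2)) (Ls := Ls) (continuous_fundamentalRep (Fin 2))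
    fundamentalRep_mem_unitaryGroup (β₁ / 2) (β₂ / 2) h1 hΩ heig

/-- **`ln λ₀(β₂) − ln λ₀(β₁) ≤ ((β₂ − β₁)/2)·Φ(β₂/2)`** for the `SU(2)` tube, for every nonnegative unit vacuum `Ω'` of `T_{β₂/2}`.
[cite: Kingman1961] [cite: MontvayMunster1994, §3.2.6] -/
theorem su2_rectTube_log_norm_secant_le (β₁ β₂ : ℝ) (Ls : Fin k → ℕ) [∀ i, NeZero (Ls i)]
    {Ω' : Lp ℝ 2 (rectSliceMeasure (Matrix.specialUnitaryGroup (Fin 2) ℂ) Ls)} (h1 : ‖Ω'‖ = 1)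
    (hΩ : ∀ᵐ a ∂(rectSliceMeasure (Matrix.specialUnitaryGroup (Fin 2) ℂ) Ls), 0 ≤ Ω' a)
    (heig : rectTubeTransferOperator (fundamentalRep (Fin 2)) (β₂ / 2) Ls Ω' =
      ‖rectTubeTransferOperator (fundamentalRep (Fin 2)) (β₂ / 2) Ls‖ • Ω') :
    Real.log ‖rectTubeTransferOperator (fundamentalRep (Fin 2)) (β₂ / 2) Ls‖ -
        Real.log ‖rectTubeTransferOperator (fundamentalRep (Fin 2)) (β₁ / 2) Ls‖ ≤
      (β₂ / 2 - β₁ / 2) * (‖rectTubeTransferOperator (fundamentalRep (Fin 2)) (β₂ / 2) Ls‖⁻¹ *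
      ∫ z, ((rectMagSum (Ls := Ls) (fundamentalRep (Fin 2)) z.1 + rectMagSum (Ls := Ls) (fundamentalRep (Fin 2)) z.2) / 2 +
          (∫ E, rectElecSum (Ls := Ls) (fundamentalRep (Fin 2)) z.1 E z.2 *
                Real.exp (β₂ / 2 * rectElecSum (Ls := Ls) (fundamentalRep (Fin 2)) z.1 E z.2)
              ∂(Measure.pi fun _ : RectTorusSite Ls => haarProbability (Matrix.specialUnitaryGroup (Fin 2) ℂ))) /
            (∫ E, Real.exp (β₂ / 2 * rectElecSum (Ls := Ls) (fundamentalRep (Fin 2)) z.1 E z.2)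
              ∂(Measure.pi fun _ : RectTorusSite Ls => haarProbability (Matrix.specialUnitaryGroup (Fin 2) ℂ)))) *
        (Ω' z.1 * rectSliceKernel (Ls := Ls) (fundamentalRep (Fin 2)) (β₂ / 2) (β₂ / 2) z.1 z.2 * Ω' z.2)
        ∂((rectSliceMeasure (Matrix.specialUnitaryGroup (Fin 2) ℂ) Ls).prod
          (rectSliceMeasure (Matrix.specialUnitaryGroup (Fin 2) ℂ) Ls))) := by
  haveI : SecondCountableTopology (Matrix.specialUnitaryGroup (Fin 2) ℂ) :=
    Literature.MathematicalPhysics.QuantumLattice.secondCountableTopology_su2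
  exact rectTube_log_norm_sub_le_coupling (fundamentalRep (Fin 2)) (Ls := Ls) (continuous_fundamentalRep (Fin 2))
    fundamentalRep_mem_unitaryGroup (β₁ / 2) (β₂ / 2) h1 hΩ heig

end SU2

end Summit.Ventures.YMGap.FlowData
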